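import Summits.Ventures.CertifiedManyBodySolver.Theorems.CovHg1201M19bKinematicPartsTp
import HarnessLib

/-!
# Theorems/CovHg1201M19bBottomSlackLadder.lean — route «CovHg1201M19b» (Hg-1201 @ 0 GPa), crux «PatchBottom» (stmt-Ventures-26187):
# the SLACK-SCHEDULE adapter (captain RULING «TP-KINCUT» 2026-08-28T10:37:56Z (4); hubbard-cov-hg1201-ref-1 structural note 10:37:23Z)

Supports stmt-Ventures-26187 (box-1 g1's item; typed here as the @0 twin of the @10 adapter the captain assigned to this seat — TP-KINCUT (4) —, to be CONSUMED BY NAME). In the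
uniform corner-objective form (box-1's `Theorems/CovHg1201M19b{StubAdapters,BoxRowWAdapters,StripClosers}.lean`, this seat's `…KinematicPartsTp.lean`) every source `s`
of a bottom cell must certify the CORNER objective `−X₀(−27/50, 7/2)` below the bar `0.5166800`. But the target-slot word at `σ` is the `σ`-CHORD
`a(σ)·(corner value) + b(σ)·(inner END value)`, `a(σ) = (−13/25 − σ)·50`, `b(σ) = (σ + 27/50)·50`, and the inner END value is KINEMATIC (`≤ 0.5152137` at every
`n ≤ 183/200`, `hg1201_innerKinematicReading_le`); a source `s` only serves targets `σ ≥ s`. Hence a cell `[s₁, s₂]` of sources needs only the SLACK price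
`a(s₁)·(−r) + b(s₁)·0.5152137 ≤ 0.5166800` — equal to `−r ≤ bar` at the corner `s₁ = −27/50` and looser inward (tolerance `→ ∞` as `s₁ → −13/25`; at `s₁ = −53/100`:
`−r ≤ 0.5181463`). This file types that schedule:
* §1 `covHg1201M19b_slotWord_of_cornerValue_slack` — one corner value `v` at a source, slack price at a slot `σ₀ ≤ σ` ⇒ the target-slot word at `σ`;
* §2 `covHg1201M19b_bottomCell_of_boxRowW_slack` — ONE windowed cell `![7/2, s₁, n₁] … ![7/2, s₂, n₂]` (`−27/50 ≤ s₁`, `s₂ ≤ −13/25`, kinematic floor discharged, cap by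
  `hcap`) with the slack price AT ITS OUTER EDGE `s₁` ⇒ the bottom bundle for all targets `σ ∈ [−27/50, −13/25]` and sources `s ∈ [s₁, s₂]`, `s ≤ σ`;
* §3 `covHg1201M19b_PatchBottom_of_bottomCellsW_slackLadder` — «PatchBottom» from a `t′`-LADDER of windowed cells `[P k, P (k+1)]` covering the TP-KINCUT
  sub-span `[−27/50, −53/100]` on the density strip `[179/200, 183/200]`, cell `k` priced at `P k` (densities `n ≤ 179/200` and slots `σ ≥ −53/100` state-free).
HONEST FRAMING: bookkeeping + one-body kinematics; zero solve, no claim node, no definition; §2–§3 CONDITIONAL on cell rows no certificate supplies yet; certified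
stiffness-scale CEILINGS on a downfolded screening-grade box = CONTROL / CALIBRATION + labelled heuristic (xx1; content = below 0.98 × the kinematic MAJORANT `0.5272245`,
no suppression below free claimed); a ceiling never speaks to the presence of
superconductivity; not a `T_c` or phase sentence; NO item or stub is closed by this file. Seat hubbard-cov-hg1201-box-2 g1 (`prover-hubbard-cov-hg1201-box-2-g0-0`).
-/

noncomputable section

namespace Summit.Ventures.CertifiedManyBodySolver.Theorems

open Set Filter Topology
open Summit.Ventures.CertifiedManyBodySolver.Theses.CovHg1201M19b
open Summit.Ventures.CertifiedManyBodySolver.Observables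
open Summit.Ventures.CertifiedManyBodySolver.Downfold
open Summit.Ventures.CertifiedManyBodySolver.Certificates
open Summit.Ventures.CertifiedManyBodySolver
open Literature.MathematicalPhysics.QuantumLattice Literature.MathematicalPhysics.QuantumLattice.ThermodynamicLimit
open Literature.Probability.LatticeModels
open Matrix HubbardWave0
open scoped BigOperators ComplexOrder

/-! ## §1 The target-slot word from ONE corner value under the SLACK price -/

/-- **Slack-schedule chord (@0).** For a slot `σ ∈ [σ₀, −13/25]` with `−27/50 ≤ σ₀`, a density `0 ≤ n ≤ 183/200`, a torus limit `ω` of unit sector ground states of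
`hubbardTorusTT' L 1 s U_A'` at density `n`, a value `v ≤` the orbit mean of `−X₀(−27/50, U_A)`, and the SLACK PRICE at `σ₀`:
`(−13/25 − σ₀)·50·(−v) + (σ₀ + 27/50)·50·0.5152137 ≤ 0.5166800` — the orbit mean of `−X₀(σ, U_A)` is `≥ −0.5166800`. (The price at `σ ≥ σ₀` is implied: if
`−v ≤ 0.5152137` the chord is a convex combination of two sub-bar numbers, otherwise the price decreases in `σ`.)
[cite: KomaTasaki1994, §1] [cite: LiebLoss1993, §8, Theorem 8.2] [cite: HazraVermaRanderia2019, eq. (4)] -/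
theorem covHg1201M19b_slotWord_of_cornerValue_slack (σ σ₀ UA s UA' : ℝ) (hσ₀ : -27 / 50 ≤ σ₀) (hσ : σ ∈ Icc σ₀ (-13 / 25))
    {n : ℝ} (hn0 : 0 ≤ n) (hn : n ≤ 183 / 200) {v : ℝ}
    (hprice : (-13 / 25 - σ₀) * 50 * (-v) + (σ₀ - -27 / 50) * 50 * (5152137 / 10000000 : ℝ) ≤ (5166800 / 10000000 : ℝ))
    (ω : InfVolFermionState 2) (Ls : ℕ → ℕ) (ψ : ∀ L, Fock (Orb (FermionTorus 2 L)))
    (hLs : Tendsto Ls atTop atTop)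
    (hψ : ∀ j, IsGroundStateInSector (hubbardTorusTT' (Ls j) 1 s UA') (rectN n (Ls j)) 0 (ψ (Ls j)))
    (h1 : ∀ j, star (ψ (Ls j)) ⬝ᵥ ψ (Ls j) = 1) (hω : ω.IsTorusLimitOf ψ Ls)
    (hP : v ≤ ((Finset.univ : Finset (DihedralGroup 4)).card : ℝ)⁻¹ * ∑ g ∈ (Finset.univ : Finset (DihedralGroup 4)),
      (ω.expect (d4ShiftSet g 0 (box 2 7)) (fermionEmbed (PolySite.d4Emb g 0 (box 2 7)) (-oddMomentObsTT (-27 / 50) UA 0))).re) :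
    -(5166800 / 10000000 : ℝ) ≤ ((Finset.univ : Finset (DihedralGroup 4)).card : ℝ)⁻¹ * ∑ g ∈ (Finset.univ : Finset (DihedralGroup 4)),
      (ω.expect (d4ShiftSet g 0 (box 2 7)) (fermionEmbed (PolySite.d4Emb g 0 (box 2 7)) (-oddMomentObsTT σ UA 0))).re := by
  have hn2 : n < 2 := by linarith
  have hσI : σ ∈ Icc (-27 / 50 : ℝ) (-13 / 25) := ⟨hσ₀.trans hσ.1, hσ.2⟩
  have hchord := orbitLower_slot_chord_of_two_endObjectives hω.isTranslationInvariant UA (by norm_num : (-27 / 50 : ℝ) < -13 / 25) hσI hP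
    (orbitMean_neg_oddMomentTT_lam_zero_ge_kinematic_of_gs (-13 / 25) UA s UA' halfBathtub_m13o25_chordLevel_le hn0 hn2 ω Ls ψ hLs hψ h1 hω)
  -- the kinematic inner-END value `Q n ≤ 0.5152137`
  set Q := (43731 / 90112 : ℝ) * n / 2 + ((9 / 11 : ℝ) * 0.3123804228 + 2 / 11 * 0.2068368242) with hQ_def
  have hQ : Q ≤ 5152137 / 10000000 := by
    have h := hg1201_innerKinematicReading_le hn
    push_cast at h
    rw [hQ_def]; exact h
  -- chord weights at σ and at σ₀
  obtain ⟨ha, hb, hab⟩ := hg1201_patch_slotWeights hσI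
  set a := (-13 / 25 - σ) / (-13 / 25 - -27 / 50) with ha_def
  set b := (σ - -27 / 50) / (-13 / 25 - -27 / 50) with hb_def
  have ha₀ : a ≤ (-13 / 25 - σ₀) * 50 := by
    rw [ha_def, div_eq_mul_inv]; norm_num; linarith [hσ.1]
  have hb₀ : (σ₀ - -27 / 50) * 50 ≤ b := by
    rw [hb_def, div_eq_mul_inv]; norm_num; linarith [hσ.1]
  have hab₀ : (-13 / 25 - σ₀) * 50 + (σ₀ - -27 / 50) * 50 = (1 : ℝ) := by ring
  -- the price at σ is below the bar
  have hpriceσ : a * (-v) + b * (5152137 / 10000000 : ℝ) ≤ 5166800 / 10000000 := by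
    rcases le_or_gt (-v) (5152137 / 10000000 : ℝ) with hv | hv
    · calc a * (-v) + b * (5152137 / 10000000 : ℝ) ≤ a * (5152137 / 10000000) + b * (5152137 / 10000000) :=
            add_le_add (mul_le_mul_of_nonneg_left hv ha) le_rfl
        _ = 5152137 / 10000000 := by rw [← add_mul, hab, one_mul]
        _ ≤ 5166800 / 10000000 := by norm_num
    · -- `−v` above the inner value: the price decreases in `σ`, so the price at `σ₀` dominates
      have hb' : b = 1 - a := by linarith [hab]
      have hb₀' : (σ₀ - -27 / 50) * 50 = 1 - (-13 / 25 - σ₀) * 50 := by linarith [hab₀]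
      rw [hb']
      rw [hb₀'] at hprice
      nlinarith [ha₀, hv, hprice]
  have hQb : b * (-Q) ≥ b * (-(5152137 / 10000000 : ℝ)) := by
    have := mul_le_mul_of_nonneg_left hQ hb
    linarith
  have : a * v + b * (-Q) ≥ -(5166800 / 10000000 : ℝ) := by nlinarith [hpriceσ, hQb]
  linarith [hchord, this]

/-! ## §2 The bottom bundle from ONE windowed cell priced at its OUTER edge -/

/-- **Bottom bundle from ONE WINDOWED cell `![7/2, s₁, n₁] … ![7/2, s₂, n₂]` under the slack schedule** (`−27/50 ≤ s₁`, `s₂ ≤ −13/25`, `0 ≤ n₁`, `n₂ ≤ 183/200`; floor row =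
the a-priori kinematic constant, discharged; cap row `cap` by `hcap`; SLACK PRICE at the outer edge `s₁`): for every `n ∈ [n₁, n₂]`, every target `σ ∈ [s₁, −13/25]` and
every source `s ∈ [s₁, s₂]` with `s ≤ σ`, the «PatchBottom» body. [cite: KomaTasaki1994, §1] [cite: ScalapinoWhiteZhang1993, §II] [cite: WangEtAl2024, §III] -/
theorem covHg1201M19b_bottomCell_of_boxRowW_slack {n₁ n₂ s₁ s₂ : ℝ} (hn₁ : 0 ≤ n₁) (hn₂ : n₂ ≤ 183 / 200)
    (hs₁ : -27 / 50 ≤ s₁) (hs₂ : s₂ ≤ -13 / 25) {cap : (Fin 3 → ℝ) → ℝ} {r : ℚ} (Uo : ℝ)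
    (hrow : SquareTTPrimeCorrOrbitLowerBoxRowW ![7 / 2, s₁, n₁] ![7 / 2, s₂, n₂]
      (fun _ : Fin 3 → ℝ => (((-124827703/50000000 : ℚ)) : ℝ)) cap r Finset.univ (box 2 7) (-oddMomentObsTT (-27 / 50) Uo 0))
    (hcap : ∀ θ ∈ Set.Icc (![7 / 2, s₁, n₁] : Fin 3 → ℝ) ![7 / 2, s₂, n₂], energyDensityTT' 1 (θ 1) (θ 0) (θ 2) ≤ cap θ)
    (hprice : (-13 / 25 - s₁) * 50 * (-((r : ℚ) : ℝ)) + (s₁ - -27 / 50) * 50 * (5152137 / 10000000 : ℝ) ≤ (5166800 / 10000000 : ℝ)) :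
    ∀ n ∈ Set.Icc n₁ n₂, ∀ σ ∈ Set.Icc s₁ (-13 / 25), ∀ s ∈ Set.Icc s₁ s₂, s ≤ σ →
      ∀ (ω : InfVolFermionState 2) (Ls : ℕ → ℕ) (ψ : ∀ L, Fock (Orb (FermionTorus 2 L))),
      Tendsto Ls atTop atTop →
      (∀ j, IsGroundStateInSector (hubbardTorusTT' (Ls j) 1 s (7 / 2)) (rectN n (Ls j)) 0 (ψ (Ls j))) →
      (∀ j, star (ψ (Ls j)) ⬝ᵥ ψ (Ls j) = 1) → ω.IsTorusLimitOf ψ Ls →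
      -(5166800 / 10000000 : ℝ) ≤ ((Finset.univ : Finset (DihedralGroup 4)).card : ℝ)⁻¹ * ∑ g ∈ (Finset.univ : Finset (DihedralGroup 4)),
        (ω.expect (d4ShiftSet g 0 (box 2 7)) (fermionEmbed (PolySite.d4Emb g 0 (box 2 7)) (-oddMomentObsTT σ (7 / 2) 0))).re := by
  intro n hn σ hσ s hs hsσ ω Ls ψ hLs hψ h1 hω
  have hθ : (![7 / 2, s, n] : Fin 3 → ℝ) ∈ Set.Icc (![7 / 2, s₁, n₁] : Fin 3 → ℝ) ![7 / 2, s₂, n₂] :=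
    covHg1201_vec3_mem_Icc le_rfl le_rfl hs.1 hs.2 hn.1 hn.2
  have hflo : (fun _ : Fin 3 → ℝ => (((-124827703/50000000 : ℚ)) : ℝ)) ![7 / 2, s, n] ≤
      energyDensityTT' 1 ((![7 / 2, s, n] : Fin 3 → ℝ) 1) ((![7 / 2, s, n] : Fin 3 → ℝ) 0) ((![7 / 2, s, n] : Fin 3 → ℝ) 2) := by
    have hsabs : |s| ≤ 27 / 50 := by
      rw [abs_le]; constructor <;> linarith [hs.1, hs.2]
    simpa using hg1201_M19b_apriori_kinFloor hsabs (U := 7 / 2) (by norm_num) (hn₁.trans hn.1) (by linarith [hn.2, hn₂])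
  have hP : ((r : ℚ) : ℝ) ≤ ((Finset.univ : Finset (DihedralGroup 4)).card : ℝ)⁻¹ * ∑ g ∈ (Finset.univ : Finset (DihedralGroup 4)),
      (ω.expect (d4ShiftSet g 0 (box 2 7)) (fermionEmbed (PolySite.d4Emb g 0 (box 2 7)) (-oddMomentObsTT (-27 / 50) (7 / 2) 0))).re := by
    rw [covHg1201_neg_oddMomentObsTT_lam_zero_label (-27 / 50) (7 / 2) Uo]
    exact hrow _ hθ ω Ls ψ hLs hψ h1 hω hflo (hcap _ hθ)
  exact covHg1201M19b_slotWord_of_cornerValue_slack σ s₁ (7 / 2) s (7 / 2) hs₁ hσ (hn₁.trans hn.1) (hn.2.trans hn₂) hprice ω Ls ψ hLs hψ h1 hω hP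

/-! ## §3 «PatchBottom» from a t′-LADDER of windowed cells under the slack schedule -/

/-- Locating a point of `[P 0, P m]` in a segment `[P k, P (k+1)]`, `k < m`. [folklore] -/
private theorem exists_ladder_segment_slack (P : ℕ → ℝ) :
    ∀ m : ℕ, 0 < m → ∀ x : ℝ, P 0 ≤ x → x ≤ P m → ∃ k < m, P k ≤ x ∧ x ≤ P (k + 1)
  | 0, hm, _, _, _ => (Nat.lt_irrefl 0 hm).elim
  | (m + 1), _, x, h0, hm1 => by
      by_cases hle : x ≤ P m
      · rcases Nat.eq_zero_or_pos m with hm0 | hmpos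
        · subst hm0
          exact ⟨0, Nat.zero_lt_succ 0, h0, hm1⟩
        · obtain ⟨k, hk, h1, h2⟩ := exists_ladder_segment_slack P m hmpos x h0 hle
          exact ⟨k, Nat.lt_succ_of_lt hk, h1, h2⟩
      · exact ⟨m, Nat.lt_succ_self m, le_of_lt (not_le.mp hle), hm1⟩

/-- **«PatchBottom» (stmt-Ventures-26187) from a t′-LADDER of windowed bottom cells under the SLACK SCHEDULE.** Breakpoints `P 0 = −27/50, …, P m = −53/100` (all in
`[−27/50, −53/100]`); for each `k < m` ONE windowed cell `![7/2, P k, 179/200] … ![7/2, P (k+1), 183/200]` (kinematic floor row discharged, cap row `cap k` by `hcap k`) with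
the slack price AT `P k`: `(−13/25 − P k)·50·(−r k) + (P k + 27/50)·50·0.5152137 ≤ 0.5166800` (= `−r 0 ≤ bar` for the corner cell, looser inward). Densities `n ≤ 179/200`
and slots `σ ≥ −53/100` are state-free (box-2 g0 / TP-KINCUT). CONDITIONAL on the rows. [cite: ScalapinoWhiteZhang1993, §II] [cite: KomaTasaki1994, §1] [cite: BoydVandenberghe2004, §5.9] -/
theorem covHg1201M19b_PatchBottom_of_bottomCellsW_slackLadder (P : ℕ → ℝ) {m : ℕ} (hP0 : P 0 = -27 / 50) (hPm : P m = -53 / 100)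
    (hPlo : ∀ k ≤ m, -27 / 50 ≤ P k) (hPhi : ∀ k ≤ m, P k ≤ -53 / 100) (cap : ℕ → (Fin 3 → ℝ) → ℝ) (r : ℕ → ℚ) (Uo : ℝ)
    (hrow : ∀ k < m, SquareTTPrimeCorrOrbitLowerBoxRowW ![7 / 2, P k, 179 / 200] ![7 / 2, P (k + 1), 183 / 200]
      (fun _ : Fin 3 → ℝ => (((-124827703/50000000 : ℚ)) : ℝ)) (cap k) (r k) Finset.univ (box 2 7) (-oddMomentObsTT (-27 / 50) Uo 0))
    (hcap : ∀ k < m, ∀ θ ∈ Set.Icc (![7 / 2, P k, 179 / 200] : Fin 3 → ℝ) ![7 / 2, P (k + 1), 183 / 200], energyDensityTT' 1 (θ 1) (θ 0) (θ 2) ≤ cap k θ)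
    (hprice : ∀ k < m, (-13 / 25 - P k) * 50 * (-((r k : ℚ) : ℝ)) + (P k - -27 / 50) * 50 * (5152137 / 10000000 : ℝ) ≤ (5166800 / 10000000 : ℝ)) :
    PatchBottom := by
  have hm : 0 < m := by
    rcases Nat.eq_zero_or_pos m with h | h
    · exfalso; subst h; rw [hP0] at hPm; norm_num at hPm
    · exact h
  refine covHg1201M19b_PatchBottom_of_outerStrip (fun n hn σ hσ s hs ω Ls ψ hLs hψ h1 hω => ?_)
  obtain ⟨k, hk, hPk, hPk1⟩ := exists_ladder_segment_slack P m hm s (by rw [hP0]; exact hs.1) (by rw [hPm]; exact hs.2.trans hσ.2)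
  have hPk_lo : -27 / 50 ≤ P k := hPlo k hk.le
  exact covHg1201M19b_bottomCell_of_boxRowW_slack (by norm_num) le_rfl hPk_lo ((hPhi (k + 1) hk).trans (by norm_num)) Uo (hrow k hk) (hcap k hk)
    (hprice k hk) n hn σ ⟨hPk.trans hs.2, hσ.2.trans (by norm_num)⟩ s ⟨hPk, hPk1⟩ hs.2 ω Ls ψ hLs hψ h1 hω
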